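import Summits.ResolutionOfSingularities.ResolutionOfSingularities.Theorems.MarkedTransferCampaignW46MohWindowSurfaceHeavyCore
import Summits.ResolutionOfSingularities.ResolutionOfSingularities.Theorems.MarkedTransferCampaignW46MohWindowSurfaceHeavyChart
import Summits.ResolutionOfSingularities.ResolutionOfSingularities.Theorems.MarkedTransferCampaignW46MohWindowSurfacePermissible
import HarnessLib

/-!
# [OURS · L1 W4.6 rung (iii-2), piece (H)] Surface Moh window — the HEAVY ONE-STEP BOUND: over an ARBITRARY window point the
# residual order of the transform satisfies `d′ + p ≤ d + μ ≤ 2d` — the excess `d − p` at most doubles in one permissible blow-up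
# (cell res-hironaka, LADDER-RESOLUTION rung L, D-0089; unit res-L1-s46-pv-12 carried by res-D-pv-050; host MarkedTransfer,
# `--supports stmt-ResolutionOfSingularities-16155 --as helper`; object #1 of res-D-pv-008 AS res-L1-s46-pv-14's census
# `D/res-D-pv-008/H2-CENSUS.md`)

HONEST FRAMING. Nothing here is a statement of H. Hironaka's manuscript [Hironaka2017] and nothing here asserts that any statement
of it holds. THEOREMS about res-L1-type-o1's OURS regime `CampaignW46.Regime.mohWindowSurface` (`…W46MohWindowSurface.lean` §5: `E.b = p`,
`Sing(E)` a finite set of closed points, a COEFFICIENT window presentation `J_ξ = (z^p + Σ_{k ≤ d} a_k x^{d−k} y^k)`, `p < d < 2p`, a unit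
among the `a_k`, at every singular point — NO tameness) and o1's presentation-free `residualOrder` (§6). Sibling of the tame step
`…MohWindowSurfaceStep.lean` / `…Permissible.lean` (there: `d′ < d`); here the root of the residue binary form under the singular point
upstairs may have ANY multiplicity `μ ≤ d`, and the conclusion is the Moh-type bound
* `MohWindowSurface.exponent_le_of_chart_of_factor` — ring level, Rees chart `i ∈ {0,1}`: every window presentation upstairs has
  exponent `d₁` with `d₁ + p ≤ d + M` whenever every prime of `κ[Y]` divides the residue polynomial to a power `≤ M`
  (`…HeavyChart.lean` + `core_le` of `…HeavyCore.lean`); `exponent_le_of_chart`: `d₁ + p ≤ 2d` (`M = d`, unit coefficient);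
* `MohWindowSurfaceHeavy.residualOrder_le_of_over_centre` — scheme level, résumé-free: for a blow-up `π` of a §2.1-permissible centre
  with source AND transform in `Regime.mohWindowSurface`, at every singular `ξ′` over the centre
  `residualOrder(ξ′) + p ≤ 2 · residualOrder(π ξ′)`, i.e. with `e := d − p`: `e′ ≤ 2e`.
SHARP: res-D-pv-008's kernel growth witness `MohWindowSurfaceGrowth.exists_growth_step_residualOrder` has `d = p + 1 ↦ d′ = p + 2`
(`e = 1 ↦ 2`, equality). In the TAME case `μ < p` the same chain gives the drop `d′ < d` (`…Step.lean`); on the heavy side the bound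
permits stall (`μ = p`) and growth by `μ − p` — the arithmetic of the Moh window, now kernel-checked for the typed procedure's states.
AI-written; AI review is weaker than expert review. No `sorry`; axioms standard. [folklore] [Moh1987] [HauserWagner2014]
-/

noncomputable section

set_option linter.dupNamespace false -- mandated namespace of this single-conjunct summit

open CategoryTheory AlgebraicGeometry TopologicalSpace IsLocalRing

namespace Summit.ResolutionOfSingularities.ResolutionOfSingularities.Theorems

namespace CampaignW46

open Literature.AlgebraicGeometry.Resolution
open Literature.AlgebraicGeometry.Hironaka2017.S02Preliminaries
open Literature.AlgebraicGeometry.Hironaka2017.Datum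
open Literature.AlgebraicGeometry.Hironaka2017.S16Proof
open Scheme.IdealSheafData
open Polynomial

universe u

/-! ## 1. Ring level: the exponent bound in the charts `i ∈ {0, 1}` -/

namespace MohWindowSurface

/-- **[OURS · L1 W4.6 rung (iii-2), piece (H)] Ring-level heavy step with a multiplicity bound `M`.** `R → L` (`ψ`) the stalk map at
a point `ξ′` of the blow-up of a window point, presented through the Rees chart `i ∈ {0,1}` (`L` a localisation of `R[𝔪/c_i]` at a
prime `𝔴` over `𝔪_R`, `ψ = χ ∘ (c ↦ c/1)`): if every prime `π` of `κ[Y]` divides the residue polynomial `Σ ā_k X^{u_k}` (`u_k ≤ d`)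
of the window equation `g = c₂^p + Σ a_k c_i^{d−u_k} c_{i'}^{u_k}` (`p < d < 2p`) exactly to a power `μ ≤ M`, the transform ideal
`I′ = ((ψ g) : (ψ c_i)^p)` lies in `𝔪_L^p` (the point is singular) and has a window presentation
`I′ = (z₁^p + Σ a′_k x₁^{d′−k} y₁^k)` with `p < d′ < 2p`, and `𝔪_L` needs three generators, then `d′ + p ≤ d + M`. Proof = the tame
`exponent_lt_of_chart` with `exists_core_data_of_factor` and `core_le` in place of `exists_core_data` and `core`. NOT a statement of
the manuscript. [folklore] -/
theorem exponent_le_of_chart_of_factor {R : Type u} [CommRing R] [IsRegularLocalRing R] (p : ℕ) [Fact p.Prime]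
    (h3 : (maximalIdeal R).spanFinrank = 3) (c : Fin 3 → R) (hc : Ideal.span (Set.range c) = maximalIdeal R)
    {i i' : Fin 3} (hi : i ≠ 2) (hi' : i' ≠ 2) (hii' : i ≠ i') {d : ℕ} (hpd : p < d) (hd2 : d < 2 * p) (a : ℕ → R)
    (u : ℕ → ℕ) (hu : ∀ k, u k ≤ d) {M : ℕ}
    (hfactor : ∀ π : (ResidueField R)[X], Prime π → ∃ (μ : ℕ) (G₀ : (ResidueField R)[X]),
      μ ≤ M ∧ (∑ k ∈ Finset.range (d + 1), C (residue R (a k)) * X ^ (u k)) = π ^ μ * G₀ ∧ ¬ π ∣ G₀)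
    (𝔴 : Ideal (chartRing c i)) [𝔴.IsPrime] (h𝔴 : 𝔴.comap (chartBase c i) = maximalIdeal R)
    (L : Type u) [CommRing L] [IsLocalRing L] [Algebra (chartRing c i) L] [IsLocalization.AtPrime L 𝔴] [CharP L p]
    (h3L : (maximalIdeal L).spanFinrank = 3) (ψ : R →+* L)
    (hψ : ∀ r, ψ r = (algebraMap (chartRing c i) L : chartRing c i →+* L) (chartBase c i r))
    {I' : Ideal L}
    (hI' : I' = Submodule.colon (Ideal.span {ψ (c 2 ^ p + ∑ k ∈ Finset.range (d + 1), a k * c i ^ (d - u k) * c i' ^ (u k))})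
      ((Ideal.span {ψ (c i)} ^ p : Ideal L) : Set L))
    (hsing : I' ≤ maximalIdeal L ^ p) {x₁ y₁ z₁ : L} (hxyz₁ : Ideal.span {x₁, y₁, z₁} = maximalIdeal L) {d₁ : ℕ}
    (hpd₁ : p < d₁) (hd2₁ : d₁ < 2 * p) (a₁ : ℕ → L)
    (hI₁ : I' = Ideal.span {z₁ ^ p + ∑ k ∈ Finset.range (d₁ + 1), a₁ k * x₁ ^ (d₁ - k) * y₁ ^ k}) : d₁ + p ≤ d + M := by
  classical
  have hp1 : 1 ≤ p := (Fact.out : p.Prime).one_lt.le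
  set alg : chartRing c i →+* L := (algebraMap (chartRing c i) L : chartRing c i →+* L) with halg
  -- `L` is regular, `ψ (c i)` is a non-zero regular parameter
  have hz0 : Ideal.span (Set.range (Fin.append c (fun k : Fin 0 => Fin.elim0 k : Fin 0 → R))) = maximalIdeal R := by
    rw [span_range_append_elim0]; exact hc
  have hd0 : (maximalIdeal R).spanFinrank = 3 + 0 := by rw [h3]
  have hrsop := isRsopPart_chartFamily_reesChart c i (fun k : Fin 0 => Fin.elim0 k) hz0 hd0 𝔴 h𝔴 L
    (a := 0) (fun k : Fin 0 => Fin.elim0 k) (Function.injective_of_subsingleton _) (fun k => Fin.elim0 k)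
  haveI hLreg : IsRegularLocalRing L := hrsop.isRegularLocalRing
  haveI : IsDomain L := isDomain_of_isRegularLocalRing L
  have hci : ψ (c i) ∈ maximalIdeal L := by
    have h0 := hrsop.mem_maximalIdeal 0
    rw [hψ]; simpa only [chartFamily, Fin.cons_zero] using h0
  have hci0 : ψ (c i) ≠ 0 := by
    have h0 := hrsop.ne_zero 0
    rw [hψ]; simpa only [chartFamily, Fin.cons_zero] using h0
  -- chart relations and the factorisation of the pulled-back equation
  have hrel : ∀ l, ψ (c l) = ψ (c i) * alg (chartGen c i l) := fun l => by
    rw [hψ, hψ, halg, ← map_mul, ← reesChartBase_apply_eq_mul_chartGen c i l]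
  set f : L := ∑ k ∈ Finset.range (d + 1), alg (chartBase c i (a k)) * alg (chartGen c i i') ^ (u k) with hf
  have hfψ : ∑ k ∈ Finset.range (d + 1), ψ (a k) * alg (chartGen c i i') ^ (u k) = f := by
    rw [hf]; refine Finset.sum_congr rfl fun k _ => ?_; rw [hψ]
  have hfac := map_window_eq_chart ψ (hrel i') (hrel 2) hpd.le a u hu
  rw [hfψ] at hfac
  -- the transform ideal is principal, generated by `g₁ = e₂^p + ψ(c_i)^{d-p} f`
  set g₁ : L := alg (chartGen c i 2) ^ p + ψ (c i) ^ (d - p) * f with hg₁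
  have hI'eq : I' = Ideal.span {g₁} := by
    rw [hI', hfac, colon_span_pow_mul (mem_nonZeroDivisors_of_ne_zero hci0)]
  -- `e₂ ∈ 𝔪_L` since `g₁ ∈ I′ ⊆ 𝔪^p ⊆ 𝔪`
  have hg₁m : g₁ ∈ maximalIdeal L := by
    have : g₁ ∈ I' := by rw [hI'eq]; exact Ideal.mem_span_singleton_self _
    exact Ideal.pow_le_self (by omega) (hsing this)
  have hz : alg (chartGen c i 2) ∈ maximalIdeal L := by
    have h1 : ψ (c i) ^ (d - p) * f ∈ maximalIdeal L :=
      Ideal.mul_mem_right _ _ (Ideal.pow_mem_of_mem _ hci _ (Nat.sub_pos_of_lt hpd))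
    have h2 : alg (chartGen c i 2) ^ p ∈ maximalIdeal L := by
      have := Ideal.sub_mem _ hg₁m h1
      rwa [hg₁, add_sub_cancel_right] at this
    exact Ideal.IsPrime.mem_of_pow_mem inferInstance p h2
  -- the data of `core_le`, multiplicity `μ ≤ M`
  obtain ⟨-, ρ, G, μ, hμM, hGu, hgen, hfρ⟩ := exists_core_data_of_factor h3 c hc hi hi' hii' a u hfactor 𝔴 h𝔴 L h3L hz
  rw [← hψ] at hgen hfρ
  rw [← hf] at hfρ
  -- the upstairs presentation in the shape of `core`
  have hz₁ : z₁ ∈ maximalIdeal L :=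
    hxyz₁ ▸ Ideal.subset_span (Set.mem_insert_of_mem _ (Set.mem_insert_of_mem _ (Set.mem_singleton _)))
  have hf₁ : ∑ k ∈ Finset.range (d₁ + 1), a₁ k * x₁ ^ (d₁ - k) * y₁ ^ k ∈ maximalIdeal L ^ d₁ := by
    have hle : Ideal.span {x₁, y₁} ≤ maximalIdeal L := by
      rw [← hxyz₁]
      refine Ideal.span_mono ?_
      intro b hb
      rcases hb with rfl | rfl
      · exact Set.mem_insert _ _
      · exact Set.mem_insert_of_mem _ (Set.mem_insert _ _)
    exact Ideal.pow_right_mono hle d₁ (coeffForm_mem_span_pow x₁ y₁ d₁ a₁)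
  obtain ⟨m, hm⟩ : ∃ m, d = p + m := ⟨d - p, (Nat.add_sub_cancel' hpd.le).symm⟩
  have hm1 : 1 ≤ m := by omega
  have hmp : m < p := by omega
  have hdm : d - p = m := by omega
  rw [hdm] at hg₁
  have heq : Ideal.span {alg (chartGen c i 2) ^ p + ψ (c i) ^ m * f} =
      Ideal.span {z₁ ^ p + ∑ k ∈ Finset.range (d₁ + 1), a₁ k * x₁ ^ (d₁ - k) * y₁ ^ k} := by
    rw [← hg₁, ← hI'eq, hI₁]
  have := core_le p h3L hgen hm1 hmp hGu hfρ hz₁ hf₁ hpd₁ hd2₁ heq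
  omega

/-- **[OURS · L1 W4.6 rung (iii-2), piece (H)] Ring-level heavy step, `d′ + p ≤ 2d`.** As `exponent_le_of_chart_of_factor` with the
factorisation supplied by `exists_eq_pow_mul_le` (`M = d`): the residue polynomial only has to be NON-ZERO (in the rung: a unit among
the window coefficients). NOT a statement of the manuscript. [folklore] -/
theorem exponent_le_of_chart {R : Type u} [CommRing R] [IsRegularLocalRing R] (p : ℕ) [Fact p.Prime]
    (h3 : (maximalIdeal R).spanFinrank = 3) (c : Fin 3 → R) (hc : Ideal.span (Set.range c) = maximalIdeal R)
    {i i' : Fin 3} (hi : i ≠ 2) (hi' : i' ≠ 2) (hii' : i ≠ i') {d : ℕ} (hpd : p < d) (hd2 : d < 2 * p) (a : ℕ → R)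
    (u : ℕ → ℕ) (hu : ∀ k, u k ≤ d)
    (hF0 : ∑ k ∈ Finset.range (d + 1), C (residue R (a k)) * X ^ (u k) ≠ 0)
    (𝔴 : Ideal (chartRing c i)) [𝔴.IsPrime] (h𝔴 : 𝔴.comap (chartBase c i) = maximalIdeal R)
    (L : Type u) [CommRing L] [IsLocalRing L] [Algebra (chartRing c i) L] [IsLocalization.AtPrime L 𝔴] [CharP L p]
    (h3L : (maximalIdeal L).spanFinrank = 3) (ψ : R →+* L)
    (hψ : ∀ r, ψ r = (algebraMap (chartRing c i) L : chartRing c i →+* L) (chartBase c i r))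
    {I' : Ideal L}
    (hI' : I' = Submodule.colon (Ideal.span {ψ (c 2 ^ p + ∑ k ∈ Finset.range (d + 1), a k * c i ^ (d - u k) * c i' ^ (u k))})
      ((Ideal.span {ψ (c i)} ^ p : Ideal L) : Set L))
    (hsing : I' ≤ maximalIdeal L ^ p) {x₁ y₁ z₁ : L} (hxyz₁ : Ideal.span {x₁, y₁, z₁} = maximalIdeal L) {d₁ : ℕ}
    (hpd₁ : p < d₁) (hd2₁ : d₁ < 2 * p) (a₁ : ℕ → L)
    (hI₁ : I' = Ideal.span {z₁ ^ p + ∑ k ∈ Finset.range (d₁ + 1), a₁ k * x₁ ^ (d₁ - k) * y₁ ^ k}) : d₁ + p ≤ 2 * d := by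
  have h := exponent_le_of_chart_of_factor p h3 c hc hi hi' hii' hpd hd2 a u hu (M := d)
    (fun _ hπ => exists_eq_pow_mul_le (fun k => residue R (a k)) u hu hF0 hπ) 𝔴 h𝔴 L h3L ψ hψ hI' hsing hxyz₁ hpd₁ hd2₁ a₁ hI₁
  omega

end MohWindowSurface

/-! ## 2. Scheme level: one permissible blow-up inside `Regime.mohWindowSurface` (résumé-free) -/

namespace MohWindowSurfaceHeavy

variable {p : ℕ} [Fact p.Prime] {K : Type u} [Field K] [CharP K p]
variable {A A' : AmbientDatum p K} {E : IdealExponent A.Z}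

/-- **[OURS · L1 W4.6 rung (iii-2), piece (H)] THE HEAVY ONE-STEP BOUND OVER THE CENTRE.** For the blow-up `π` of a §2.1-permissible
centre `D` (in the regime: one closed point `ξ ∈ Sing(E)`) with source `(A, E)` AND transform `(A′, E.transform π D)` in
`Regime.mohWindowSurface` (coefficient window presentations, `E.b = p`, NO tameness), at every singular point `ξ′` of the transform
over the centre: `residualOrder(ξ′) + p ≤ 2 · residualOrder(ξ)` — the excess `d − p` at most doubles. SHARP by res-D-pv-008's
`MohWindowSurfaceGrowth.exists_growth_step_residualOrder` (`p + 1 ↦ p + 2`). The `z`-chart is impossible (unit cofactor); in the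
charts `x`, `y` this is `MohWindowSurface.exponent_le_of_chart` (residue polynomial non-zero by the unit coefficient), the residual
orders being the exponents by res-D-pv-008's uniqueness (`residualOrder_coeff`). NOT a statement of the manuscript. [folklore] -/
theorem residualOrder_le_of_over_centre {D : Closeds A.Z} (π : A'.Z ⟶ A.Z) (hπ : IsBlowup π (vanishingIdeal D))
    (hD : E.IsPermissibleCentre A.hom D) (hRg : Regime.mohWindowSurface A E)
    (hRg' : Regime.mohWindowSurface A' (E.transform π D)) {x' : A'.Z} (hx' : x' ∈ (E.transform π D).sing)
    (hover : π.base x' ∈ (D : Set A.Z)) :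
    (residualOrder (E.transform π D).b (A'.Z.presheaf.stalk x') (stalkIdeal (E.transform π D).J x')).toNat + p ≤
      2 * (residualOrder E.b (A.Z.presheaf.stalk (π.base x')) (stalkIdeal E.J (π.base x'))).toNat := by
  classical
  obtain ⟨ξ, hξS, hξcl, hDξ⟩ := IsPermissibleCentre.exists_eq_singleton_of_isolatedSing hD ⟨hRg.2.1, hRg.2.2.1⟩
  have hπx : π.base x' = ξ := by simpa [hDξ] using hover
  obtain ⟨hb, -, -, hwin⟩ := hRg
  obtain ⟨-, -, -, hwin'⟩ := hRg'
  have hbE' : (E.transform π D).b = E.b := rfl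
  haveI : IsLocallyNoetherian A'.Z := by
    haveI := A'.smooth
    exact LocallyOfFiniteType.isLocallyNoetherian A'.hom
  have hp1 : 1 ≤ p := (Fact.out : p.Prime).one_lt.le
  -- the tame presentation downstairs, at `π x' = ξ`
  obtain ⟨hRreg, h3, x, y, z, hxyz, d, a, hbd, hd2, hunit, hJ⟩ := hwin _ (hπx ▸ hξS)
  rw [hb] at hbd hd2 hJ
  haveI := hRreg
  -- the residue polynomial is non-zero: a unit among the coefficients
  obtain ⟨j, hj, hju⟩ := id hunit
  have haj : residue _ (a j) ≠ 0 := (residue_ne_zero_iff_isUnit _).mpr hju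
  -- the tame presentation upstairs, at `x'`
  obtain ⟨hLreg, h3L, x₁, y₁, z₁, hxyz₁, d₁, a₁, hbd₁, hd2₁, hunit₁, hJ₁⟩ := hwin' _ hx'
  rw [hbE', hb] at hbd₁ hd2₁ hJ₁
  haveI := hLreg
  haveI : CharP (A.Z.presheaf.stalk (π.base x')) p := Lem16p11Proof.charP_stalk A (𝟙 A.Z) _
  haveI : CharP (A'.Z.presheaf.stalk x') p := Lem16p11Proof.charP_stalk A π x'
  -- both residual orders are the exponents
  rw [hbE', hb, hJ, hJ₁, MohWindowSurface.residualOrder_coeff p hLreg h3L hxyz₁ hbd₁ hd2₁ hunit₁,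
    MohWindowSurface.residualOrder_coeff p hRreg h3 hxyz hbd hd2 hunit, ENat.toNat_coe, ENat.toNat_coe]
  -- the Rees chart at `x'`
  set c : Fin 3 → A.Z.presheaf.stalk (π.base x') := ![x, y, z] with hc_def
  have hc : Ideal.span (Set.range c) = maximalIdeal _ := by rw [hc_def, MohWindowSurface.range_vec3]; exact hxyz
  have hY : stalkIdeal (vanishingIdeal D) (π.base x') = maximalIdeal (A.Z.presheaf.stalk (π.base x')) := by
    apply stalkIdeal_vanishingIdeal_eq_maximalIdeal_of_closure_eq
    rw [hDξ, hπx, hξcl.closure_eq]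
  have hcY : Ideal.span (Set.range c) = stalkIdeal (vanishingIdeal D) (π.base x') := hc.trans hY.symm
  obtain ⟨j, 𝔴, χ, hχ, hloc, h𝔴⟩ := hπ.exists_reesChart_stalk x' c hcY
  letI := χ.toAlgebra
  haveI : IsLocalization.AtPrime (A'.Z.presheaf.stalk x') 𝔴.asIdeal := hloc
  set ψ : A.Z.presheaf.stalk (π.base x') →+* A'.Z.presheaf.stalk x' := (π.stalkMap x').hom with hψ
  have hψa : ∀ r, ψ r = (algebraMap (chartRing c j) (A'.Z.presheaf.stalk x') :
      chartRing c j →+* A'.Z.presheaf.stalk x') (chartBase c j r) := fun r => (hχ r).symm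
  have hrel : ∀ l, ψ (c l) = ψ (c j) * χ (chartGen c j l) := stalkMap_apply_eq_mul_chartGen j χ hχ
  -- the stalk of the transform is the colon `((ψ g) : (ψ c_j)^p)`
  have hCmap : (stalkIdeal (vanishingIdeal D) (π.base x')).map ψ = Ideal.span {ψ (c j)} := by
    rw [← hcY, Ideal.map_span_range_eq_span_singleton _ c j _ hrel]
  have hstalk : stalkIdeal (E.transform π D).J x' =
      Submodule.colon (Ideal.span {ψ (z ^ p + ∑ k ∈ Finset.range (d + 1), a k * x ^ (d - k) * y ^ k)})
        ((Ideal.span {ψ (c j)} ^ p : Ideal _) : Set _) := by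
    show stalkIdeal (controlledTransform π (vanishingIdeal D) E.J E.b) x' = _
    rw [controlledTransform, stalkIdeal_colon, stalkIdeal_pow, stalkIdeal_comap_eq_map_stalkMap,
      stalkIdeal_comap_eq_map_stalkMap, ← hψ, hCmap, hJ, Ideal.map_span, Set.image_singleton, hb]
  have hx'sing : stalkIdeal (E.transform π D).J x' ≤ maximalIdeal _ ^ p := by
    have := (le_idealOrder_iff (E.transform π D).J x' (E.transform π D).b).mp hx'
    rwa [hbE', hb] at this
  have hcj : ψ (c j) ∈ maximalIdeal _ := by
    rw [hψa]
    exact (IsLocalization.AtPrime.to_map_mem_maximal_iff _ 𝔴.asIdeal _).mpr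
      (by rw [← Ideal.mem_comap, h𝔴, ← hc]; exact Ideal.subset_span ⟨j, rfl⟩)
  haveI : IsDomain (A'.Z.presheaf.stalk x') := isDomain_of_isRegularLocalRing _
  -- which chart?
  obtain rfl | rfl | rfl : j = 0 ∨ j = 1 ∨ j = 2 := by
    rcases j with ⟨j, hj⟩
    have : j = 0 ∨ j = 1 ∨ j = 2 := by omega
    rcases this with rfl | rfl | rfl
    · exact Or.inl rfl
    · exact Or.inr (Or.inl rfl)
    · exact Or.inr (Or.inr rfl)
  · -- chart `x`: free letter `y`, `u k = min k d`
    have hF0 : ∑ k ∈ Finset.range (d + 1), C (residue _ (a k)) * X ^ (min k d) ≠ 0 :=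
      MohWindowSurface.sum_C_mul_X_pow_min_ne_zero (fun k => residue _ (a k)) hj haj
    refine MohWindowSurface.exponent_le_of_chart p h3 c hc (i := 0) (i' := 1) (by decide) (by decide) (by decide) hbd hd2
      a (fun k => min k d) (fun k => min_le_right k d) hF0 𝔴.asIdeal h𝔴 _ h3L ψ hψa (I' := stalkIdeal (E.transform π D).J x') ?_
      hx'sing hxyz₁ hbd₁ hd2₁ a₁ hJ₁
    rw [hstalk, window_sum_chart_zero]
    rfl
  · -- chart `y`: free letter `x`, `u k = d - k`
    have hF0 : ∑ k ∈ Finset.range (d + 1), C (residue _ (a k)) * X ^ (d - k) ≠ 0 :=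
      MohWindowSurface.sum_C_mul_X_pow_sub_ne_zero (fun k => residue _ (a k)) hj haj
    refine MohWindowSurface.exponent_le_of_chart p h3 c hc (i := 1) (i' := 0) (by decide) (by decide) (by decide) hbd hd2
      a (fun k => d - k) (fun k => Nat.sub_le d k) hF0 𝔴.asIdeal h𝔴 _ h3L ψ hψa (I' := stalkIdeal (E.transform π D).J x') ?_
      hx'sing hxyz₁ hbd₁ hd2₁ a₁ hJ₁
    rw [hstalk, window_sum_chart_one]
    rfl
  · -- chart `z`: the cofactor is a unit, the transform is the unit ideal — `x'` would not be singular
    exfalso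
    have hfac := MohWindowSurface.map_window_eq_chart_two ψ (hrel 0) (hrel 1) hbd.le a (d := d)
    have hunit2 := MohWindowSurface.isUnit_chart_two_cofactor hcj hbd
      (S := ∑ k ∈ Finset.range (d + 1), ψ (a k) * χ (chartGen c 2 0) ^ (d - k) * χ (chartGen c 2 1) ^ k)
    have hne : ψ (c 2) ≠ 0 := by
      have hz0 : Ideal.span (Set.range (Fin.append c (fun k : Fin 0 => Fin.elim0 k : Fin 0 → _))) = maximalIdeal _ := by
        rw [MohWindowSurface.span_range_append_elim0]; exact hc
      have hd0 : (maximalIdeal (A.Z.presheaf.stalk (π.base x'))).spanFinrank = 3 + 0 := by rw [h3]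
      have hrsop := isRsopPart_chartFamily_reesChart c 2 (fun k : Fin 0 => Fin.elim0 k) hz0 hd0 𝔴.asIdeal h𝔴
        (A'.Z.presheaf.stalk x') (a := 0) (fun k : Fin 0 => Fin.elim0 k) (Function.injective_of_subsingleton _)
        (fun k => Fin.elim0 k)
      have h0 := hrsop.ne_zero 0
      rw [hψa]; simpa only [chartFamily, Fin.cons_zero] using h0
    have htop : stalkIdeal (E.transform π D).J x' = ⊤ := by
      rw [hstalk]
      have : ψ (z ^ p + ∑ k ∈ Finset.range (d + 1), a k * x ^ (d - k) * y ^ k) =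
          ψ (c 2) ^ p * (1 + ψ (c 2) ^ (d - p) *
            ∑ k ∈ Finset.range (d + 1), ψ (a k) * χ (chartGen c 2 0) ^ (d - k) * χ (chartGen c 2 1) ^ k) := hfac
      rw [this, MohWindowSurface.colon_span_pow_mul (mem_nonZeroDivisors_of_ne_zero hne), Ideal.span_singleton_eq_top]
      exact hunit2
    have h1 : (1 : A'.Z.presheaf.stalk x') ∈ maximalIdeal _ := by
      have := hx'sing (htop ▸ Submodule.mem_top : (1 : A'.Z.presheaf.stalk x') ∈ stalkIdeal (E.transform π D).J x')
      exact Ideal.pow_le_self (by omega) this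
    exact (maximalIdeal.isMaximal _).ne_top ((Ideal.eq_top_iff_one _).mpr h1)

/-- **The same bound read on the excess `e := residualOrder − p`**: `e(ξ′) ≤ 2 · e(π ξ′)` (natural subtraction; both residual orders
exceed `p` in the regime). NOT a statement of the manuscript. [folklore] -/
theorem excess_le_two_mul_of_over_centre {D : Closeds A.Z} (π : A'.Z ⟶ A.Z) (hπ : IsBlowup π (vanishingIdeal D))
    (hD : E.IsPermissibleCentre A.hom D) (hRg : Regime.mohWindowSurface A E)
    (hRg' : Regime.mohWindowSurface A' (E.transform π D)) {x' : A'.Z} (hx' : x' ∈ (E.transform π D).sing)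
    (hover : π.base x' ∈ (D : Set A.Z)) :
    (residualOrder (E.transform π D).b (A'.Z.presheaf.stalk x') (stalkIdeal (E.transform π D).J x')).toNat - p ≤
      2 * ((residualOrder E.b (A.Z.presheaf.stalk (π.base x')) (stalkIdeal E.J (π.base x'))).toNat - p) := by
  have h := residualOrder_le_of_over_centre π hπ hD hRg hRg' hx' hover
  omega

end MohWindowSurfaceHeavy

end CampaignW46

end Summit.ResolutionOfSingularities.ResolutionOfSingularities.Theorems

end
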